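import Literature.NumberTheory.Automorphic.WhittakerTwistedJacquet                  -- ★ `Representation.charTwist`, `ker_charTwist_eq_span`
import Literature.NumberTheory.Automorphic.IrreducibleClassesComap                   -- ★ `SmoothIrrep.comap`, `IrrClass.comap_mk`
import Summits.HodgeConjecture.HodgeConjecture.Theorems.R90S4TwistedCoinvariantSlot  -- ★ p862038 (this seat) `nonempty_charTwist_equiv`, `nontrivial_coinvariants_of_equiv`
import HarnessLib

/-!
# R90-TF · S4 «Ch. 13.1–2» — (SWAP) assembly, generic layer: genericity as a class invariant, its transport along pull-backs and
# conjugations, and the ORBIT ARGUMENT as pure logic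

Cell `hodgecm-mathlib`, crux H413 (`stmt-HodgeConjecture-24833`, lane `--supports … --as helper`), route of record `HCCMUnconditional`
(no route verbs; count-neutral).  Programme R90-TF (brief `director/R90-BRIEF.v2.md` 1f40d54518340a35), section S4 = Rogawski Ch. 13.1–2
(base `R90-C131`); seat R90-C131-p01 (g0), the `_ldsSwap` ASSEMBLY (dealer RULING S4-R10 (4)); this file is its CM-free layer (ASM-core),
consumed by `Theorems/R90S4U2LdsSwapOfTwo` together with K2E3-p11 (g9)'s one-parameter FRAME.  THEOREMS ONLY (no `def`, no instance,
no notation, no named fact, no `sorry`); ★-only imports.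

VOCABULARY.  For a representation `ρ` of `G`, a subgroup `N ≤ G` and a character `θ : N →* kˣ`, «`ρ` is `(N, θ)`-GENERIC» means that the
`θ`-twisted coinvariants `J(ρ|_N ⊗ θ⁻¹) = V ⁄ V(N, θ)` (★ `Representation.charTwist`, Mathlib `Coinvariants`) are non-zero, i.e.
`V(N, θ) = Coinvariants.ker (ρ.charTwist N θ) ≠ ⊤` (`nontrivial_coinvariants_iff_ker_ne_top`).

CONTENT.
* §1 `nontrivial_coinvariants_iff_ker_ne_top`; genericity is a CLASS INVARIANT (`nontrivial_coinvariants_charTwist_of_mk_eq`, via ★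
  `nonempty_charTwist_equiv` + ★ `nontrivial_coinvariants_of_equiv`).
* §2 TRANSPORT ALONG A PULL-BACK: `ker_charTwist_comp_eq` — for `φ : G′ →* G` mapping `N′` ONTO `N` and `θ ∘ φ = θ′` on `N′`,
  `V_{ρ∘φ}(N′, θ′) = V_ρ(N, θ)` (the same subspace of `V`); hence `ρ ∘ φ` is `(N′, θ′)`-generic iff `ρ` is `(N, θ)`-generic.
* §3 TRANSPORT ALONG AN INNER CONJUGATION: `ker_charTwist_ne_top_of_conj` — if `x⁻¹ N x ⊆ N` and `θ′(x⁻¹ n x) = θ(n)`, then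
  `(N, θ′)`-generic ⇒ `(N, θ)`-generic (`ρ(x⁻¹)` maps `V(N, θ)` into `V(N, θ′)`, [BernsteinZelevinskyRMS1976, §2.33]).
* §4 THE ORBIT ARGUMENT (`orbit_contradiction`), pure logic: two predicates `Gen₁, Gen₂` on a monoid of parameters with (A) no common generic
  parameter `≠ 0`, (E) each generic somewhere `≠ 0`, (I) `Gen₁` stable under the «norm» scalings, (T) `Gen₁` stable under the outer scaling `a`,
  (X) any two non-zero parameters differ by a norm or a norm times `a` — contradiction.  («`π⁺` is `ψ`-generic exactly on one `F^×∕N E^×`-orbit,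
  `π⁻` on the other; an outer similitude exchanges the orbits», [Rogawski1990, §11.1 p. 161]; [LabesseLanglands1979].)

HONEST LABEL: HC_CM is proved only modulo the 7 printed citations (2 remaining named inputs: hLiu418 = stmt-HodgeConjecture-24832,
h413 = stmt-HodgeConjecture-24833) until rung 0 closes; this file is representation-theoretic plumbing and discharges none of them.  REL ≠ ★ ≠ BUILT.

## References
[BernsteinZelevinskyASENS1977] I. N. Bernstein, A. V. Zelevinsky, Ann. Sci. ÉNS 10 (1977), §1.8 (b), Prop. 1.9 · [BernsteinZelevinskyRMS1976] —, Russian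
Math. Surveys 31:3 (1976), §2.30–§2.33 · [Rogawski1990] J. D. Rogawski, *Automorphic Representations of Unitary Groups in Three Variables* (1990),
§11.1 p. 161 · [LabesseLanglands1979] J.-P. Labesse, R. P. Langlands, *L-indistinguishability for SL(2)*, Canad. J. Math. 31 (1979), §2.
-/

set_option autoImplicit false
-- the mandated namespace (brief §3.4) repeats the single-problem summit's segment (`HodgeConjecture.HodgeConjecture`)
set_option linter.dupNamespace false

noncomputable section

open Representation Literature.NumberTheory.Automorphic

namespace Summit.HodgeConjecture.HodgeConjecture.R90.S4

universe u

/-! ## §1 Genericity: `J ≠ 0 ↔ V(N, θ) ≠ ⊤`; a class invariant -/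

section Invariant

variable {k : Type*} [Field k] {Γ : Type*} [Group Γ] {W : Type*} [AddCommGroup W] [Module k W]

/-- `J(σ) ≠ 0` iff the coinvariant kernel is a proper subspace. [cite: BernsteinZelevinskyASENS1977, §1.8 (b)] -/
theorem nontrivial_coinvariants_iff_ker_ne_top (σ : Representation k Γ W) :
    Nontrivial σ.Coinvariants ↔ Coinvariants.ker σ ≠ ⊤ := by
  rw [← not_iff_not, not_nontrivial_iff_subsingleton, not_not]
  exact Submodule.Quotient.subsingleton_iff

end Invariant

section ClassInvariant

variable {G : Type u} [Group G] [TopologicalSpace G] (N : Subgroup G) (θ : ↥N →* ℂˣ)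

/-- **Genericity is a class invariant**: if `⟦r⟧ = ⟦r′⟧` in `Irr(G)` and `r` is `(N, θ)`-generic, so is `r′` (★ `IrrClass.mk_eq_mk_iff`, ★
`nonempty_charTwist_equiv`, ★ `nontrivial_coinvariants_of_equiv`). [cite: BernsteinZelevinskyASENS1977, §1.8 (b)] -/
theorem nontrivial_coinvariants_charTwist_of_mk_eq {r r' : SmoothIrrep G} (h : IrrClass.mk r = IrrClass.mk r')
    (hr : Nontrivial (r.ρ.charTwist N θ).Coinvariants) : Nontrivial (r'.ρ.charTwist N θ).Coinvariants := by
  obtain ⟨e⟩ := (IrrClass.mk_eq_mk_iff r r').1 h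
  obtain ⟨e'⟩ := nonempty_charTwist_equiv N θ e
  haveI := hr
  exact nontrivial_coinvariants_of_equiv e'

end ClassInvariant

/-! ## §2 Transport along a pull-back `ρ ∘ φ` -/

section Comap

variable {k : Type*} [CommRing k] {G G' : Type*} [Group G] [Group G'] {V : Type*} [AddCommGroup V] [Module k V]

/-- **`V_{ρ∘φ}(N′, θ′) = V_ρ(N, θ)`** when `φ : G′ →* G` maps `N′` onto `N` and `θ(φ n′) = θ′(n′)`: both are spanned by the same vectors
`ρ(φ n′) v − θ′(n′) v = ρ(m) v − θ(m) v`, `m = φ n′` (★ `ker_charTwist_eq_span`). [cite: BernsteinZelevinskyASENS1977, §1.8 (b)] -/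
theorem ker_charTwist_comp_eq (ρ : Representation k G V) (φ : G' →* G) (N' : Subgroup G') (N : Subgroup G) (θ' : ↥N' →* kˣ) (θ : ↥N →* kˣ)
    (hφ : ∀ n : ↥N', φ n ∈ N) (hsurj : ∀ m : ↥N, ∃ n : ↥N', φ n = m) (hθ : ∀ n : ↥N', θ ⟨φ n, hφ n⟩ = θ' n) :
    Coinvariants.ker (Representation.charTwist (ρ.comp φ) N' θ') = Coinvariants.ker (ρ.charTwist N θ) := by
  rw [ker_charTwist_eq_span, ker_charTwist_eq_span]
  congr 1
  ext w
  constructor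
  · rintro ⟨⟨n, v⟩, rfl⟩
    refine ⟨⟨⟨φ n, hφ n⟩, v⟩, ?_⟩
    change ρ (φ n) v - (θ ⟨φ n, hφ n⟩ : kˣ) • v = ρ.comp φ (n : G') v - (θ' n : kˣ) • v
    rw [hθ, MonoidHom.comp_apply]
  · rintro ⟨⟨m, v⟩, rfl⟩
    obtain ⟨n, hn⟩ := hsurj m
    refine ⟨⟨n, v⟩, ?_⟩
    have hm : (⟨φ n, hφ n⟩ : ↥N) = m := Subtype.ext hn
    change ρ.comp φ (n : G') v - (θ' n : kˣ) • v = ρ (m : G) v - (θ m : kˣ) • v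
    rw [MonoidHom.comp_apply, ← hθ, hm, hn]

/-- Hence **`ρ ∘ φ` is `(N′, θ′)`-generic iff `ρ` is `(N, θ)`-generic** (same quotient `V ⁄ V(N, θ)`). [cite: BernsteinZelevinskyASENS1977, §1.8 (b)] -/
theorem nontrivial_coinvariants_charTwist_comp_iff {k : Type*} [Field k] {V : Type*} [AddCommGroup V] [Module k V]
    (ρ : Representation k G V) (φ : G' →* G) (N' : Subgroup G') (N : Subgroup G) (θ' : ↥N' →* kˣ) (θ : ↥N →* kˣ)
    (hφ : ∀ n : ↥N', φ n ∈ N) (hsurj : ∀ m : ↥N, ∃ n : ↥N', φ n = m) (hθ : ∀ n : ↥N', θ ⟨φ n, hφ n⟩ = θ' n) :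
    Nontrivial (Representation.charTwist (ρ.comp φ) N' θ').Coinvariants ↔ Nontrivial (ρ.charTwist N θ).Coinvariants := by
  rw [nontrivial_coinvariants_iff_ker_ne_top, nontrivial_coinvariants_iff_ker_ne_top, ker_charTwist_comp_eq ρ φ N' N θ' θ hφ hsurj hθ]

end Comap

/-! ## §3 Transport along an inner conjugation -/

section Conj

variable {k : Type*} [Field k] {G : Type*} [Group G] {V : Type*} [AddCommGroup V] [Module k V]

/-- **TRANSPORT OF TWISTED KERNELS** ([BernsteinZelevinskyRMS1976, §2.33]; the `map_ker_charTwist_le_of_conj` of ★ `K2E3TwistedKernelTransport`, restated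
here to keep the imports of this file ★-Literature + this seat's own): if `x⁻¹ N x ⊆ N` and `θ′(x⁻¹ n x) = θ(n)` on `N`, then `ρ(x⁻¹)` maps `V(N, θ)` into
`V(N, θ′)`. [cite: BernsteinZelevinskyRMS1976, §2.33] -/
theorem map_ker_charTwist_le_of_conj' (ρ : Representation k G V) (N : Subgroup G) (θ θ' : ↥N →* kˣ) (x : G)
    (hx : ∀ n : ↥N, x⁻¹ * (n : G) * x ∈ N) (hθ : ∀ n : ↥N, θ' ⟨x⁻¹ * (n : G) * x, hx n⟩ = θ n) :
    Submodule.map (ρ x⁻¹) (Coinvariants.ker (ρ.charTwist N θ)) ≤ Coinvariants.ker (ρ.charTwist N θ') := by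
  rw [ker_charTwist_eq_span, Submodule.map_span, Submodule.span_le]
  rintro _ ⟨_, ⟨⟨n, v⟩, rfl⟩, rfl⟩
  have key : ρ x⁻¹ (ρ (n : G) v - (θ n : kˣ) • v) =
      ρ ((⟨x⁻¹ * (n : G) * x, hx n⟩ : ↥N) : G) (ρ x⁻¹ v) - (θ' ⟨x⁻¹ * (n : G) * x, hx n⟩ : kˣ) • ρ x⁻¹ v := by
    rw [hθ, Units.smul_def, Units.smul_def, map_sub, map_smul]
    congr 1
    change ρ x⁻¹ (ρ (n : G) v) = ρ (x⁻¹ * (n : G) * x) (ρ x⁻¹ v)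
    rw [map_mul, map_mul, Module.End.mul_apply, Module.End.mul_apply, ← Module.End.mul_apply (ρ x) (ρ x⁻¹) v, ← map_mul,
      mul_inv_cancel, map_one, Module.End.one_apply]
  rw [key]
  exact sub_smul_mem_ker_charTwist ρ N θ' _ _

/-- **Genericity along an inner conjugation**: if `x⁻¹ N x ⊆ N`, `θ′(x⁻¹ n x) = θ(n)` on `N`, and `ρ` is `(N, θ′)`-generic, then `ρ` is
`(N, θ)`-generic (`V(N, θ) = V` would force `V(N, θ′) ⊇ ρ(x⁻¹) V = V`). [cite: BernsteinZelevinskyRMS1976, §2.33] -/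
theorem nontrivial_coinvariants_charTwist_of_conj (ρ : Representation k G V) (N : Subgroup G) (θ θ' : ↥N →* kˣ) (x : G)
    (hx : ∀ n : ↥N, x⁻¹ * (n : G) * x ∈ N) (hθ : ∀ n : ↥N, θ' ⟨x⁻¹ * (n : G) * x, hx n⟩ = θ n)
    (hgen : Nontrivial (ρ.charTwist N θ').Coinvariants) : Nontrivial (ρ.charTwist N θ).Coinvariants := by
  rw [nontrivial_coinvariants_iff_ker_ne_top] at hgen ⊢
  intro htop
  apply hgen
  refine eq_top_iff.2 fun v _ => ?_
  have hv : v ∈ Submodule.map (ρ x⁻¹) (Coinvariants.ker (ρ.charTwist N θ)) := by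
    refine ⟨ρ x v, by rw [htop]; exact Submodule.mem_top, ?_⟩
    rw [← Module.End.mul_apply, ← map_mul, inv_mul_cancel, map_one, Module.End.one_apply]
  exact map_ker_charTwist_le_of_conj' ρ N θ θ' x hx hθ hv

end Conj

/-! ## §4 The orbit argument (pure logic) -/

section Orbit

variable {F : Type*} [Mul F] [Zero F]

/-- **THE ORBIT ARGUMENT** behind (SWAP) ([Rogawski1990, §11.1 p. 161]; [LabesseLanglands1979, §2]).  Let `Gen₁, Gen₂` be predicates on a set of
parameters `F` with a zero and a multiplication («`πᵢ` is `ψ_c`-generic»), `norm : F → Prop` («`c` is a local norm») and `a : F` (the multiplier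
of an outer similitude).  Assume (A) no non-zero parameter is generic for both, (E) each predicate holds at some non-zero parameter, (I) `Gen₁` is
stable under scaling by norms, (T) `Gen₁` is stable under scaling by `a`, and (X) any two non-zero parameters differ by a norm or by `a` times a
norm.  Then: contradiction.  (So (T) — which follows from «the outer similitude FIXES `π₁`» — is impossible: the similitude MOVES `π₁`.)
[cite: Rogawski1990, §11.1 p. 161] -/
theorem orbit_contradiction (Gen₁ Gen₂ norm : F → Prop) (a : F)
    (hA : ∀ c, c ≠ 0 → ¬ (Gen₁ c ∧ Gen₂ c)) (hE₁ : ∃ c, c ≠ 0 ∧ Gen₁ c) (hE₂ : ∃ c, c ≠ 0 ∧ Gen₂ c)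
    (hI : ∀ c n, norm n → Gen₁ c → Gen₁ (c * n)) (hT : ∀ c, Gen₁ c → Gen₁ (c * a))
    (hX : ∀ c₁ c₂, c₁ ≠ 0 → c₂ ≠ 0 → ∃ n, norm n ∧ (c₂ = c₁ * n ∨ c₂ = c₁ * a * n)) : False := by
  obtain ⟨c₁, hc₁, h₁⟩ := hE₁
  obtain ⟨c₂, hc₂, h₂⟩ := hE₂
  obtain ⟨n, hn, h | h⟩ := hX c₁ c₂ hc₁ hc₂
  · exact hA c₂ hc₂ ⟨h ▸ hI c₁ n hn h₁, h₂⟩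
  · exact hA c₂ hc₂ ⟨h ▸ hI (c₁ * a) n hn (hT c₁ h₁), h₂⟩

end Orbit

end Summit.HodgeConjecture.HodgeConjecture.R90.S4

end
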